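import Summits.Ventures.HSemireg.WedgeHankelRecurrenceGaussNodesSeparation

/-!
# Venture HSemireg — **THE THREE-TERM RECURRENCE** of consecutive orthogonal polynomials of a positive discrete measure: if `q_{m−1}, q_m, q_{m+1}` are monic of degrees `m − 1, m, m + 1` and
# each is `(ν, w)`-orthogonal to every polynomial of smaller degree (`ν_l > 0`, `w` injective, at least `m + 1` nodes), then `q_{m+1} = (X − a_m) q_m − b_m q_{m−1}` with
# `b_m = Σ ν q_m² / Σ ν q_{m−1}² > 0` and `a_m = Σ ν w q_m² / Σ ν q_m²` — by the SELF-ORTHOGONALITY trick (a polynomial orthogonal to itself vanishes on the support), no linear algebra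

HONEST FRAMING. Part of the Lean index of the computation cell `pub-hsemireg` (seat p10 gen 42, Sunday typer «UNIFORM-IN-n»).  Real polynomials and finite sums only; no variety, no
cohomology theory, no sheaf, no Ext group and no semiregularity map is constructed here; nothing here says that HC / HC_CM / HC_AV holds; no Literature fact (unproved `Prop`) is declared or
used.  Custodian versions as in `WedgeHankelSiegelIdeal` (1/3).
SOURCES (cited).  G. Szegő, *Orthogonal Polynomials*, AMS Colloq. Publ. 23, Thm 3.2.1 (the recurrence formula `p_n(x) = (A_n x + B_n) p_{n−1}(x) − C_n p_{n−2}(x)`, `A_n, C_n > 0`; monic form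
(3.2.2)); T. S. Chihara, *An Introduction to Orthogonal Polynomials* (1978), Ch. I Thm 4.1 (monic OPS: `P_{n+1} = (x − c_{n+1}) P_n − λ_{n+1} P_{n−1}`, `λ_{n+1} > 0`) and Thm 4.2
(`λ_{n+1} = L[P_n²]/L[P_{n−1}²]`); F. R. Gantmacher, *The Theory of Matrices* II, Ch. XV §16 (Hankel forms of the moments; this lineage).
PROOF TYPED HERE.  `r₁ = q_{m+1} − (X − a) q_m` (top two coefficients killed) has degree `≤ m − 1` and is orthogonal to degree `< m − 1`; `r₂ = r₁ − c · q_{m−1}` has degree `≤ m − 2` and is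
orthogonal to degree `< m − 1`, in particular to itself, so `Σ_l ν_l r₂(w_l)² = 0` and `r₂ = 0` (it vanishes at `N > m − 2` distinct nodes); pairing the identity with `q_{m−1}` and with
`q_m` gives `b` and `a`.
DEDUP DISCLOSURE (`rg -n 'three_term|threeTerm|recurrence formula' Summits/Ventures/HSemireg/WedgeHankelRecurrence*`, 2026-09-02): the lineage's «recurrence» is the LINEAR recurrence of a
sequence (`recSpace`, Prony), not the three-term recurrence of orthogonal polynomials.  The 6 names below: 0 hits tree-wide.

WHAT IS IN THE TREE.  N269 `natDegree_sub_C_mul_le_of_monic`; Mathlib `Polynomial.eq_zero_of_natDegree_lt_card_of_eval_eq_zero`, `Monic.natDegree_mul`, `monic_X_sub_C`.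
THIS FILE (namespace `Summit.Ventures.HSemireg.Wedge.HankelOuter` continued; CHAINED on N272 (import) and N269; 0 definitions):
* §1038 `eq_zero_of_sum_mul_eval_sq_eq_zero` (self-orthogonal ⇒ zero), `sum_mul_eval_sq_pos_of_natDegree_lt` (`Σ ν q(w)² > 0` for `q ≠ 0` of degree `< N`), `natDegree_sub_mul_monic_lt`
  (two monics of equal degree differ in lower degree), `sum_mul_eval_mul_eq_sum_sq_of_monic` (`Σ ν q_m · ((X − a) q_{m−1}) = Σ ν q_m²`), **`three_term_recurrence`** (∃ `a b`,
  `q_{m+1} = (X − a) q_m − b q_{m−1}`, `b > 0`, `b Σν q_{m−1}² = Σν q_m²`, `a Σν q_m² = Σν w q_m²`), `three_term_recurrence_eval` (pointwise form).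
CAVEATS.  Existence of the orthogonal polynomials is ASSUMED (hypotheses), not constructed — N235 ∕ N265 provide them as node polynomials of Gauss rules; nothing Ext-side.  New names only.
-/

open Module Polynomial
open scoped Matrix Polynomial

namespace Summit.Ventures.HSemireg.Wedge.HankelOuter

/-! ## §1038. The three-term recurrence -/

/-- **Self-orthogonal ⇒ zero**: if `ν_l > 0`, `w` is injective on `Fin N`, `deg r < N` and `Σ_l ν_l r(w_l)² = 0`, then `r = 0`. [mechanism; this file, §1038] -/
theorem eq_zero_of_sum_mul_eval_sq_eq_zero {N : ℕ} {ν w : Fin N → ℝ} (hν : ∀ l, 0 < ν l) (hw : Function.Injective w) {r : ℝ[X]} (hr : r.natDegree < N)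
    (h : ∑ l, ν l * (r.eval (w l)) ^ 2 = 0) : r = 0 := by
  have hnn : ∀ l ∈ (Finset.univ : Finset (Fin N)), 0 ≤ ν l * (r.eval (w l)) ^ 2 := fun l _ => mul_nonneg (hν l).le (sq_nonneg _)
  have hall := (Finset.sum_eq_zero_iff_of_nonneg hnn).1 h
  have hz : ∀ l, r.eval (w l) = 0 := fun l => by
    have := hall l (Finset.mem_univ l)
    rcases mul_eq_zero.1 this with h1 | h1
    · exact absurd h1 (hν l).ne'
    · exact (pow_eq_zero_iff two_ne_zero).1 h1
  exact eq_zero_of_natDegree_lt_card_of_eval_eq_zero r hw hz (by rw [Fintype.card_fin]; exact hr)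

/-- `Σ_l ν_l q(w_l)² > 0` for `q ≠ 0` of degree `< N` (positive weights, distinct nodes). [mechanism; this file, §1038] -/
theorem sum_mul_eval_sq_pos_of_natDegree_lt {N : ℕ} {ν w : Fin N → ℝ} (hν : ∀ l, 0 < ν l) (hw : Function.Injective w) {q : ℝ[X]} (hq : q ≠ 0) (hqd : q.natDegree < N) :
    0 < ∑ l, ν l * (q.eval (w l)) ^ 2 := by
  refine lt_of_le_of_ne (Finset.sum_nonneg fun l _ => mul_nonneg (hν l).le (sq_nonneg _)) fun h => hq ?_
  exact eq_zero_of_sum_mul_eval_sq_eq_zero hν hw hqd h.symm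

/-- Two monic polynomials of the same degree `m ≥ 1` differ by a polynomial of degree `< m`. [bookkeeping; this file, §1038] -/
theorem natDegree_sub_lt_of_monic_of_natDegree_eq {m : ℕ} (hm : 1 ≤ m) {P Q : ℝ[X]} (hP : P.Monic) (hPd : P.natDegree = m) (hQ : Q.Monic) (hQd : Q.natDegree = m) :
    (P - Q).natDegree < m := by
  have h := natDegree_sub_C_mul_le_of_monic hPd.le hQ hQd
  have hc : P.coeff m = 1 := by rw [← hPd]; exact hP.coeff_natDegree
  rw [hc, C_1, one_mul] at h
  omega

/-- `Σ_l ν_l q_m(w_l) · ((w_l − a) q_{m−1}(w_l)) = Σ_l ν_l q_m(w_l)²` when `q_m ⊥` degree `< m` and both `q_m`, `(X − a) q_{m−1}` are monic of degree `m`. [mechanism; this file, §1038] -/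
theorem sum_mul_eval_mul_eq_sum_sq_of_monic {N m : ℕ} {ν w : Fin N → ℝ} (hm : 1 ≤ m) {q₀ q₁ : ℝ[X]} (h0m : q₀.Monic) (h0d : q₀.natDegree = m - 1) (h1m : q₁.Monic)
    (h1d : q₁.natDegree = m) (h1o : ∀ G : ℝ[X], G.natDegree < m → ∑ l, ν l * (q₁ * G).eval (w l) = 0) (a : ℝ) :
    ∑ l, ν l * (q₁.eval (w l) * ((Polynomial.X - C a) * q₀).eval (w l)) = ∑ l, ν l * (q₁.eval (w l)) ^ 2 := by
  have hPm : ((Polynomial.X - C a) * q₀).Monic := (monic_X_sub_C a).mul h0m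
  have hPd : ((Polynomial.X - C a) * q₀).natDegree = m := by rw [(monic_X_sub_C a).natDegree_mul h0m, natDegree_X_sub_C, h0d]; omega
  have hlow := natDegree_sub_lt_of_monic_of_natDegree_eq hm hPm hPd h1m h1d
  have h0 := h1o _ hlow
  simp only [eval_mul, eval_sub, mul_sub] at h0
  rw [Finset.sum_sub_distrib, sub_eq_zero] at h0
  rw [show ∑ l, ν l * (q₁.eval (w l)) ^ 2 = ∑ l, ν l * (q₁.eval (w l) * q₁.eval (w l)) from Finset.sum_congr rfl fun l _ => by rw [pow_two]]
  rw [← h0]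
  exact Finset.sum_congr rfl fun l _ => by rw [eval_mul, eval_sub]

/-- **THE THREE-TERM RECURRENCE (Szegő Thm 3.2.1 ∕ Chihara I Thm 4.1–4.2), discrete positive measure.**  Let `ν_l > 0`, `w` injective on `Fin N`, `1 ≤ m`, `m + 1 ≤ N`; let `q₀, q₁, q₂` be
monic of degrees `m − 1, m, m + 1`, each `(ν, w)`-orthogonal to all polynomials of smaller degree.  Then there are `a, b` with
`q₂ = (X − a) q₁ − b q₀`, `b > 0`, `b · Σ ν q₀(w)² = Σ ν q₁(w)²` and `a · Σ ν q₁(w)² = Σ ν w q₁(w)²`. [Szegő Thm 3.2.1; Chihara I Thm 4.1–4.2; this file, §1038] -/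
theorem three_term_recurrence {N m : ℕ} {ν w : Fin N → ℝ} (hν : ∀ l, 0 < ν l) (hw : Function.Injective w) (hm : 1 ≤ m) (hN : m + 1 ≤ N)
    {q₀ q₁ q₂ : ℝ[X]} (h0m : q₀.Monic) (h0d : q₀.natDegree = m - 1) (h1m : q₁.Monic) (h1d : q₁.natDegree = m) (h2m : q₂.Monic) (h2d : q₂.natDegree = m + 1)
    (h0o : ∀ G : ℝ[X], G.natDegree < m - 1 → ∑ l, ν l * (q₀ * G).eval (w l) = 0)
    (h1o : ∀ G : ℝ[X], G.natDegree < m → ∑ l, ν l * (q₁ * G).eval (w l) = 0)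
    (h2o : ∀ G : ℝ[X], G.natDegree < m + 1 → ∑ l, ν l * (q₂ * G).eval (w l) = 0) :
    ∃ a b : ℝ, q₂ = (Polynomial.X - C a) * q₁ - C b * q₀ ∧ 0 < b ∧
      b * ∑ l, ν l * (q₀.eval (w l)) ^ 2 = ∑ l, ν l * (q₁.eval (w l)) ^ 2 ∧ a * ∑ l, ν l * (q₁.eval (w l)) ^ 2 = ∑ l, ν l * (w l * (q₁.eval (w l)) ^ 2) := by
  -- step 1: kill the top coefficient: `r = q₂ − X q₁`, `deg r ≤ m`
  have hXm : (Polynomial.X * q₁).Monic := monic_X.mul h1m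
  have hXd : (Polynomial.X * q₁).natDegree = m + 1 := by rw [monic_X.natDegree_mul h1m, natDegree_X, h1d]; ring
  set r : ℝ[X] := q₂ - Polynomial.X * q₁ with hr
  have hrd : r.natDegree ≤ m := by
    have h := natDegree_sub_C_mul_le_of_monic h2d.le hXm hXd
    have hc : q₂.coeff (m + 1) = 1 := by rw [← h2d]; exact h2m.coeff_natDegree
    rw [hc, C_1, one_mul] at h
    simpa using h
  -- step 2: kill the next coefficient with `q₁`: `r₁ = r − c q₁`, `deg r₁ ≤ m − 1`
  set c : ℝ := r.coeff m with hc
  set r₁ : ℝ[X] := r - C c * q₁ with hr₁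
  have hr₁d : r₁.natDegree ≤ m - 1 := natDegree_sub_C_mul_le_of_monic hrd h1m h1d
  -- `q₂ = (X − a) q₁ + r₁` with `a = −c`
  have hq₂ : q₂ = (Polynomial.X - C (-c)) * q₁ + r₁ := by rw [hr₁, hr, C_neg]; ring
  -- `r₁` is orthogonal to degree `< m − 1`
  have hr₁o : ∀ G : ℝ[X], G.natDegree < m - 1 → ∑ l, ν l * (r₁ * G).eval (w l) = 0 := fun G hG => by
    have e : r₁ * G = q₂ * G - q₁ * ((Polynomial.X - C (-c)) * G) := by rw [hq₂]; ring
    have hdeg : ((Polynomial.X - C (-c)) * G).natDegree < m := by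
      refine lt_of_le_of_lt natDegree_mul_le ?_
      rw [natDegree_X_sub_C]; omega
    have h2 := h2o G (by omega)
    have h1 := h1o _ hdeg
    rw [e]
    simp only [eval_sub, mul_sub, Finset.sum_sub_distrib, h1, h2, sub_self]
  -- step 3: `r₁ = c' q₀` (kill one more coefficient with `q₀`; the rest is self-orthogonal, hence zero)
  set c' : ℝ := r₁.coeff (m - 1) with hc'
  set r₂ : ℝ[X] := r₁ - C c' * q₀ with hr₂
  have hr₂z : r₂ = 0 := by
    rcases (show m = 1 ∨ 2 ≤ m by omega) with h1 | h2
    · -- `m = 1`: `r₁` is a constant and `q₀ = 1`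
      subst h1
      have h00 : (1 : ℕ) - 1 = 0 := rfl
      have hq₀ : q₀ = 1 := eq_one_of_monic_natDegree_zero h0m (by rw [h0d])
      have hr₁c : r₁ = C (r₁.coeff 0) := eq_C_of_natDegree_le_zero (by rw [h00] at hr₁d; exact hr₁d)
      rw [hr₂, hq₀, mul_one, hc', h00, ← hr₁c, sub_self]
    · have hr₂d : r₂.natDegree ≤ m - 2 := by
        have := natDegree_sub_C_mul_le_of_monic hr₁d h0m h0d
        simpa [show m - 1 - 1 = m - 2 by omega] using this
      have hr₂o : ∀ G : ℝ[X], G.natDegree < m - 1 → ∑ l, ν l * (r₂ * G).eval (w l) = 0 := fun G hG => by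
        have e : r₂ * G = r₁ * G - C c' * (q₀ * G) := by rw [hr₂]; ring
        rw [e]
        simp only [eval_sub, eval_mul, eval_C, mul_sub, Finset.sum_sub_distrib]
        have h0 := h0o G hG
        have h1 := hr₁o G hG
        simp only [eval_mul] at h0 h1
        rw [h1, show ∑ l, ν l * (c' * (q₀.eval (w l) * G.eval (w l))) = c' * ∑ l, ν l * (q₀.eval (w l) * G.eval (w l)) by
          rw [Finset.mul_sum]; exact Finset.sum_congr rfl fun l _ => by ring, h0, mul_zero, sub_zero]
      have hself := hr₂o r₂ (by omega)
      refine eq_zero_of_sum_mul_eval_sq_eq_zero hν hw (by omega) ?_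
      rw [← hself]
      exact Finset.sum_congr rfl fun l _ => by rw [eval_mul, pow_two]
  have hr₁eq : r₁ = C c' * q₀ := by rw [← sub_eq_zero, ← hr₂]; exact hr₂z
  -- the recurrence with `a = −c`, `b = −c'`
  have hrec : q₂ = (Polynomial.X - C (-c)) * q₁ - C (-c') * q₀ := by rw [hq₂, hr₁eq, C_neg, C_neg]; ring
  -- `b`: pair with `q₀`
  have hpos0 : 0 < ∑ l, ν l * (q₀.eval (w l)) ^ 2 := sum_mul_eval_sq_pos_of_natDegree_lt hν hw h0m.ne_zero (by rw [h0d]; omega)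
  have hpos1 : 0 < ∑ l, ν l * (q₁.eval (w l)) ^ 2 := sum_mul_eval_sq_pos_of_natDegree_lt hν hw h1m.ne_zero (by rw [h1d]; omega)
  have hb : (-c') * ∑ l, ν l * (q₀.eval (w l)) ^ 2 = ∑ l, ν l * (q₁.eval (w l)) ^ 2 := by
    have h20 := h2o q₀ (by rw [h0d]; omega)
    rw [hrec] at h20
    have hA := sum_mul_eval_mul_eq_sum_sq_of_monic hm h0m h0d h1m h1d h1o (-c)
    have key : ∑ l, ν l * (((Polynomial.X - C (-c)) * q₁ - C (-c') * q₀) * q₀).eval (w l)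
        = ∑ l, ν l * (q₁.eval (w l) * ((Polynomial.X - C (-c)) * q₀).eval (w l)) - (-c') * ∑ l, ν l * (q₀.eval (w l)) ^ 2 := by
      rw [Finset.mul_sum, ← Finset.sum_sub_distrib]
      refine Finset.sum_congr rfl fun l _ => ?_
      simp only [eval_mul, eval_sub, eval_X, eval_C]
      ring
    rw [key, hA] at h20
    linarith
  -- `a`: pair with `q₁`
  have ha : (-c) * ∑ l, ν l * (q₁.eval (w l)) ^ 2 = ∑ l, ν l * (w l * (q₁.eval (w l)) ^ 2) := by
    have h21 := h2o q₁ (by rw [h1d]; omega)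
    rw [hrec] at h21
    have h01 : ∑ l, ν l * (q₁.eval (w l) * q₀.eval (w l)) = 0 := by
      have := h1o q₀ (by rw [h0d]; omega)
      simpa only [eval_mul] using this
    have key : ∑ l, ν l * (((Polynomial.X - C (-c)) * q₁ - C (-c') * q₀) * q₁).eval (w l)
        = ∑ l, ν l * (w l * (q₁.eval (w l)) ^ 2) - (-c) * ∑ l, ν l * (q₁.eval (w l)) ^ 2 - (-c') * ∑ l, ν l * (q₁.eval (w l) * q₀.eval (w l)) := by
      rw [Finset.mul_sum, Finset.mul_sum, ← Finset.sum_sub_distrib, ← Finset.sum_sub_distrib]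
      refine Finset.sum_congr rfl fun l _ => ?_
      simp only [eval_mul, eval_sub, eval_X, eval_C]
      ring
    rw [key, h01, mul_zero, sub_zero] at h21
    linarith
  refine ⟨-c, -c', hrec, ?_, hb, ha⟩
  -- `b > 0`
  by_contra hle
  rw [not_lt] at hle
  have : (-c') * ∑ l, ν l * (q₀.eval (w l)) ^ 2 ≤ 0 := mul_nonpos_iff.2 (Or.inr ⟨hle, hpos0.le⟩)
  linarith

/-- **The recurrence pointwise**: `q₂(y) = (y − a) q₁(y) − b q₀(y)`. [Szegő Thm 3.2.1; this file, §1038] -/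
theorem three_term_recurrence_eval {N m : ℕ} {ν w : Fin N → ℝ} (hν : ∀ l, 0 < ν l) (hw : Function.Injective w) (hm : 1 ≤ m) (hN : m + 1 ≤ N)
    {q₀ q₁ q₂ : ℝ[X]} (h0m : q₀.Monic) (h0d : q₀.natDegree = m - 1) (h1m : q₁.Monic) (h1d : q₁.natDegree = m) (h2m : q₂.Monic) (h2d : q₂.natDegree = m + 1)
    (h0o : ∀ G : ℝ[X], G.natDegree < m - 1 → ∑ l, ν l * (q₀ * G).eval (w l) = 0)
    (h1o : ∀ G : ℝ[X], G.natDegree < m → ∑ l, ν l * (q₁ * G).eval (w l) = 0)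
    (h2o : ∀ G : ℝ[X], G.natDegree < m + 1 → ∑ l, ν l * (q₂ * G).eval (w l) = 0) :
    ∃ a b : ℝ, 0 < b ∧ ∀ y, q₂.eval y = (y - a) * q₁.eval y - b * q₀.eval y := by
  obtain ⟨a, b, hrec, hb, -, -⟩ := three_term_recurrence hν hw hm hN h0m h0d h1m h1d h2m h2d h0o h1o h2o
  exact ⟨a, b, hb, fun y => by rw [hrec]; simp [eval_sub, eval_mul, eval_X, eval_C]⟩

end Summit.Ventures.HSemireg.Wedge.HankelOuter
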